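import Literature.MathematicalPhysics.QuantumFieldTheory.Balaban1983to89.B9Eq3153FrakGkBoundDiagonal

/-!
# `Balaban1983to89.B9Eq3153FrakGkBoundSlotDiagonal` — T. Bałaban, *Propagators for lattice gauge theories in a background field*, Commun. Math. Phys. **99**
# (1985) 389–434 [Balaban1985BackgroundPropagators] Thm 3.13 p. 426 with (3.153) p. 426, (3.130) p. 421, (3.122) p. 420, (3.120) p. 419, Thm 3.11 p. 416
# AT `k = n+1` AVERAGING LEVELS ON PRINT's DIAGONAL `ηL^{n+1} = 1`, **ABSTRACT IN THE HESSIAN SLOT**: the three Green's letters `G̃_k`, `H̃_{1,k}Q_kG̃_k`, `𝔊̃_k`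
# of `Δ̃_{a,k}(U) = Δ₁ + D_U R_k D*_U + Q_k* a Q_k` are BOUNDED in `L²` together with their flat `D`-rows, for ANY slot operator `Δ₁` whose form differs from
# the chain's Hessian `Δ^η(U)` by `θ·N₁(u)N₁(v)` with `θ ≤ γ₁∕2` — `∃ α₀ γ₁ C` BEFORE EVERY LATTICE ∕ HEIGHT ∕ WEIGHT ∕ VOLUME ∕ BACKGROUND ∕ SLOT BINDER
# (the owner's `B9Eq3153FrakGkBoundDiagonal` one storey up: print's operator `G̃⁻¹ = Δ_π + DRD* + Q*aQ` of (3.122) is the instance `Δ₁ := π_k†Δ^ηπ_k`)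
statement-level skeleton of published theorems with citation tags; proofs where landed; nothing here is a claim about the Yang–Mills mass gap

CITATION HEADER (lean-in-tree rule).  Audit cell `pub-balaban`, sub-cell `t4`, BINDER row NE9; filed by the row OWNER lineage `b2b-balaban-t4-ne9-p1`
(gen 87, plan v7 «the Δ_π port», step (iv-𝔊)).  Sources READ first-hand by this lineage in the held text layer [Balaban1985BackgroundPropagators]
(`paper:balaban1985-cmp99-background-propagators`, journal page = PDF page + 388) pp. 416 (Thm 3.11), 419–421 ((3.117)–(3.130)), 425–426 ((3.147)–(3.153),
Thm 3.13).

THE PRINT (verbatim, text layer).  p. 420: *«To calculate the last integral we have to find a minimum of the functional … on configurations A satisfying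
QA = B, and G̃⁻¹ defined as G̃⁻¹ = Δ_π + DRD* + Q*aQ. … H B = G̃Q*(QG̃Q*)⁻¹B. (3.126) We have obtained formally the same representation for the operator H as
in [3,4] (1.103), (2.35), but now the operator G̃ is much more complicated. It differs from the operator investigated in previous sections by the additional
term Δ′_π, but we will prove that this term is a small perturbation of Δ_a, and that the operator G̃ used in the above formula has all the properties
formulated in Theorems 3.3, 3.10»*; p. 421: *«G̃ = G₀(I − Δ′_πG₀)⁻¹ (3.130)»*; p. 426, Thm 3.13: *«If an external gauge field configuration U satisfies the
regularity conditions (3.35), (3.36) for α₀ sufficiently small, then Theorems 3.3, 3.10, 3.11 hold for the propagator 𝔊»*.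

WHY THIS FILE (cell context; the owner's DIAGNOSIS D-ne9p1-g87-1 and `DELTA-PI-PROGRAMME.md`).  The chain's `k`-th-step operator `B9Eq326OperatorTower.laplaceAk`
carries the BARE Hessian `Δ^η(U)` in its slot (print's `G₀`); print's `H`, `𝔊` of (3.126) ∕ (3.153) ∕ [B11] (45), (110) live on `G̃⁻¹ = Δ_π + DRD* + Q*aQ`
(3.122), typed at the `k`-th step by the owner's `B9Eq3119DeltaPiTower.laplaceAkPi` (slot `π_k†∘Δ^η(U)∘π_k`).  The owner's `B9Eq3130HessianSlotPerturbationDiagonal`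
moved the COERCIVITY, the POSITIVITY and the letter `G̃_k − G_k = O(θ)` across the slot change; THIS file moves the BOUNDS of the three pieces of (3.153) —
`B9Eq3153FrakGkBoundDiagonal` §1–§4 verbatim with `Δ^η(U) ↦ Δ₁` — so that, once the θ-letter is inhabited (`B9Eq3120DeltaPiPrimeFormDiagonal(Closed)`:
`θ = θ̄α` from (3.120) + (3.36)), [B9] Thm 3.13's `L²` clause holds for PRINT's `𝔊̃_k(U)` on the diagonal with `(d,a)`-numbers.

WHAT IS PROVED (sorry-free; 0 `def`; [folklore] composition BY NAME + threshold arithmetic; nothing of [B9] asserted as printed).  Binders as in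
`B9Eq3153FrakGkBoundDiagonal` (E162's per-level data `αU ≤ 1∕64`, `hU1`, `hreg`; windows `‖U(b) − 1‖ ≤ αη`, `‖U(∂p) − 1‖ ≤ αη²`, `ε_j ≤ αr^j`; `hRS`; `|η|^d∕c₀ ≤ ρ_w`),
then the SLOT binders: `Δ₁` a linear operator on bond fields, `0 ≤ θ ≤ γ₁∕2`, and the form defect
`‖⟨u, Δ₁v⟩ − ⟨u, Δ^η(U)v⟩‖ ≤ θ·N₁(u)·N₁(v)`, `N₁(z) = √(‖curl₁z‖² + ‖div₁z‖² + ‖z‖²)` (flat covariant curl ∕ divergence, prefactor `η⁻¹`, transporters `1`).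
Write `Δ̃ := Δ₁ + D_U R_k D*_U + Q_k* a Q_k` (`B11Eq103H1Complex.laplaceALatticeK` at the tower letters with slot `Δ₁`).
* §1 **`exists_energy_letters_slot_diagonal_closed`** — `∃ α₀ γ₁ > 0` (those of `B9Eq3153FrakGkBoundDiagonal` §1) before the binders; for every `x`:
  (i) `(γ₁∕2)(‖curl₁x‖² + ‖div₁x‖² + ‖x‖²) ≤ re⟨x, Δ̃x⟩`; (ii) `‖R_k(U)(D*_Ux)‖² ≤ 4·re⟨x, Δ̃x⟩`; (iii) `a‖Q_k(U)x‖² ≤ 4·re⟨x, Δ̃x⟩`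
  (`re⟨x, Δ̃x⟩ ≥ re⟨x, Δ_a x⟩ − θN₁(x)²` and §1 of the bare file; `θ ≤ γ₁∕2` halves the coercivity and doubles the structure letters).
* §2 **`exists_norm_G1k_slot_le_diagonal_closed`** — `∃ α₀ γ₁ C > 0` (`C = 2γ₁⁻¹`); for ANY positivity witness `hpos₁` of `Δ̃`: `‖G̃y‖, ‖curl₁(G̃y)‖, ‖div₁(G̃y)‖ ≤ C‖y‖`
  (`G̃ = B11Eq103H1Complex.G1LatticeK hpos₁`; `B9Eq3153FrakGVariational.norm_G1K_le` ∕ `norm_apply_G1K_le`).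
* §3 **`exists_norm_H1k_Qk_G1k_slot_le_diagonal_closed`** — `∃ α₀ γ₁ C > 0` (`C = 2γ₁⁻¹`); for `Δ̃` SYMMETRIC (`hsymm`; for the instance `laplaceAkPi`:
  `B9Eq3119DeltaPiTower.laplaceAkPi_isSymmetric`), ANY `hpos₁`, ANY onto-witness `hQ` of `Q_k(U)`: the three rows of `H̃_{1,k}(Q_k(G̃y))` (`B11Eq103H1Complex.H1LatticeK hpos₁ hQ`).
* §4 **`exists_norm_frakGk_slot_le_diagonal_closed`** — `∃ α₀ γ₁ C > 0` (`C = 12γ₁⁻¹`); under `hsymm`, ANY `hpos₁`, ANY `hQ`: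
  `‖𝔊̃x‖, ‖curl₁(𝔊̃x)‖, ‖div₁(𝔊̃x)‖ ≤ C‖x‖` for `𝔊̃ = B11Eq103H1Complex.frakGLatticeK hpos₁ hQ` — (3.153) in the energy currency for the PERTURBED SLOT
  (`B9Eq3153FrakGVariational.norm_frakGLin_le_of_energy` ∕ `norm_apply_frakGLin_le_of_energy` at §1's letters, `c_R = 4`, `c_P = (γ₁∕2)⁻¹`).
INSTANCE (print's operator).  For `Δ₁ := (π_k(U))† ∘ Δ^η(U) ∘ π_k(U)`, `π_k(U) = 1 − D_U∘G_p∘R_k∘D*_U`, `Δ̃` is `B9Eq3119DeltaPiTower.laplaceAkPi` by `rfl` and the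
θ-letter is `B9Eq3120DeltaPiPrimeFormDiagonal.norm_form_defect_pi_le` (`θ = θ̄·α`, modulo the two λ-letters of `B9Eq325GaugeModeLetterDiagonal`); (3.124) `Q_k𝔊̃ = 0`
is `B9Eq3119DeltaPiTower.Q_frakGLatticeK_pi` modulo (3.115).

HONEST SCOPE.  Thm 3.13's `L²`∕energy clause ONLY, on the diagonal `ηL^{n+1} = 1`, for an ABSTRACT slot with the θ-letter DISPLAYED as a hypothesis (not
inhabited here); no kernel bound (3.42)–(3.47), no decay (Thm 3.10), no Hölder norms, NOT the (N)-reading; the small-field WINDOWS, `hRS`, `C_τ`, `ρ_w` and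
(§3–§4) the symmetry of `Δ̃` stay HYPOTHESES; crude constants.  NOT summit progress (cell pub-balaban: NE9 NOT PRINTED ∕ NOT PROVED; «NE9 ⇐ the named binders»;
row WALLED ON A MODEL (O-NE9-1; #5 UNRULED); spine PROVED 0∕9; rung (B)+1 finite T⁴ — NOT infinite volume, NOT mass gap, NOT BetaPertH, NOT Clay).  HONEST
DEPENDENCY (cell line): continuum YM on T⁴ ⇐ BetaPertH ∧ nine spine estimates (0/9 proved); BetaPertH ⇐ (D1) ∧ (D4) ∧ CAP+tail; G-an2-4 gates asym, D1 and
NE2/3/4.  NEW file; nothing modified.  Net new unproved facts: 0.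
-/

noncomputable section

open scoped InnerProductSpace ComplexConjugate BigOperators

namespace Literature.MathematicalPhysics.QuantumFieldTheory.Balaban1983to89.B9Eq3153FrakGkBoundSlotDiagonal

open B4Sect5Torus (TSite)
open B9SectCLatticeCarrier (Bond)
open B11Eq103H1Complex (SiteL2K BondL2K covDerivL2K covDivL2K laplaceALatticeK laplaceAK laplaceAK_apply G1LatticeK H1LatticeK frakGLatticeK
  adjoint_covDerivL2K adjoint_injective_of_surjective projR_projR)
open B9Eq310HessianOperator (adTransportW hessOp covCurlL2K)
open B9Eq310DeltaPrime (plaqHolU)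
open B9Eq315QTorus (perCfg cornerSite)
open B9Eq315QTower (towerP UlevOf)
open B9Eq326OperatorTower (laplaceAk QkW RofUk RofUk_isSymmetric)
open B7Prop1Explicit (U1 Wcx boxVec)
open B9Eq3153FrakGkBoundDiagonal (exists_energy_letters_diagonal_closed)
open B9Eq3153FrakGVariational (norm_G1K_le norm_apply_G1K_le norm_H1K_Q_G1K_le norm_apply_H1K_Q_G1K_le norm_frakGLin_le_of_energy
  norm_apply_frakGLin_le_of_energy)

/-! ## §0 Arithmetic -/

/-- Rows from a strong coercivity `γ(c² + e² + x²) ≤ E`: `γx² ≤ E`, `c² ≤ γ⁻¹E`, `e² ≤ γ⁻¹E`. [folklore] -/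
private theorem rows_of_strong {γ c e x E : ℝ} (hγ : 0 < γ) (h : γ * (c ^ 2 + e ^ 2 + x ^ 2) ≤ E) :
    γ * x ^ 2 ≤ E ∧ c ^ 2 ≤ γ⁻¹ * E ∧ e ^ 2 ≤ γ⁻¹ * E := by
  have hc := mul_nonneg hγ.le (sq_nonneg c); have he := mul_nonneg hγ.le (sq_nonneg e); have hx := mul_nonneg hγ.le (sq_nonneg x)
  refine ⟨by linarith, ?_, ?_⟩ <;> rw [inv_mul_eq_div, le_div_iff₀' hγ] <;> linarith

/-- The real part of a difference is at least minus its norm. [folklore] -/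
private theorem re_sub_ge {z w : ℂ} {B : ℝ} (h : ‖z - w‖ ≤ B) : RCLike.re w - B ≤ RCLike.re z := by
  have h1 : |RCLike.re (z - w)| ≤ ‖z - w‖ := RCLike.abs_re_le_norm (z - w)
  have h2 : -(‖z - w‖) ≤ RCLike.re (z - w) := neg_le_of_abs_le h1
  rw [map_sub] at h2
  linarith

variable {d : ℕ} (L : ℕ) [NeZero L] (hL : 1 ≤ L)
  {𝔸 : Type*} [NormedRing 𝔸] [NormedAlgebra ℂ 𝔸] [CompleteSpace 𝔸] [NormOneClass 𝔸] [StarRing 𝔸] [NormedStarGroup 𝔸] [StarModule ℂ 𝔸]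
  {W : Type*} [NormedAddCommGroup W] [InnerProductSpace ℂ W] [FiniteDimensional ℂ W] (φ : W ≃ₗ[ℂ] 𝔸)
  {Mφ Mφ' : ℝ} (hMφ : 0 ≤ Mφ) (hMφ' : 0 ≤ Mφ') (hφ : ∀ w, ‖φ w‖ ≤ Mφ * ‖w‖) (hφ' : ∀ X, ‖φ.symm X‖ ≤ Mφ' * ‖X‖)
  {a : ℝ} (ha : 0 < a) {r : ℝ} (hr0 : 0 ≤ r) (hr1 : r < 1)
  (τ : 𝔸 →ₗ[ℂ] ℂ) {Cτ : ℝ} (hτ : ∀ X, ‖τ X‖ ≤ Cτ * ‖X‖) (hCτ : 0 ≤ Cτ) {ρw : ℝ} (hρw : 0 ≤ ρw)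

include hMφ hMφ' hφ hφ' ha hr0 hr1 hτ hCτ hρw

/-! ## §1 The energy letters of the perturbed operator -/

/-- **THE ENERGY LETTERS OF `Δ̃ = Δ₁ + D_UR_kD*_U + Q_k*aQ_k` ON THE DIAGONAL, FOR ANY SLOT `Δ₁` WITH FORM DEFECT `θ ≤ γ₁∕2` AGAINST `Δ^η(U)`**:
`∃ α₀ γ₁ > 0` before every binder; then for every `x`: (i) `(γ₁∕2)(‖curl₁x‖² + ‖div₁x‖² + ‖x‖²) ≤ re⟨x, Δ̃x⟩`; (ii) `‖R_k(U)(D*_Ux)‖² ≤ 4·re⟨x, Δ̃x⟩`;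
(iii) `a‖Q_k(U)x‖² ≤ 4·re⟨x, Δ̃x⟩` — from `B9Eq3153FrakGkBoundDiagonal.exists_energy_letters_diagonal_closed` and `re⟨x, Δ̃x⟩ ≥ re⟨x, Δ_a x⟩ − θN₁(x)²`.
[folklore] [cite: Balaban1985BackgroundPropagators, (3.130) p.421, (3.122) p.420, Thm 3.11 p.416] -/
theorem exists_energy_letters_slot_diagonal_closed :
    ∃ α₀ γ₁ : ℝ, 0 < α₀ ∧ 0 < γ₁ ∧ ∀ (n : ℕ) (η : ℝ), η * (L : ℝ) ^ (n + 1) = 1 →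
      ∀ (c₀ c₁ : ℝ) [Fact (0 < c₀)] [Fact (0 < c₁)], c₀ * ((L : ℝ) ^ (n + 1)) ^ d = c₁ → |η| ^ d / c₀ ≤ ρw →
      ∀ (m : Fin d → ℕ) [∀ i, NeZero (m i)] (U : Bond d (towerP L m (n + 1)) → 𝔸ˣ) (αU : ℕ → ℝ) (hα1 : ∀ j, αU j ≤ 1 / 64)
        (hU1 : ∀ (j : ℕ) (x : B7Prop1Explicit.Site d) (κ : Fin d), perCfg (towerP L m (j + 1)) (UlevOf L m (n + 1) U j) x κ ∈ U1 𝔸)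
        (hreg : ∀ (j : ℕ) (y : TSite d (towerP L m j)) (κ : Fin d) (r : Fin d → Fin L),
          ‖((Wcx L (perCfg (towerP L m (j + 1)) (UlevOf L m (n + 1) U j)) (cornerSite L y) κ (boxVec L r) : 𝔸ˣ) : 𝔸) - 1‖ ≤ αU j)
        (εU : ℕ → ℝ), (∀ j, 0 ≤ εU j) → (∀ (j : ℕ) (b : Bond d (towerP L m (j + 1))), ‖(UlevOf L m (n + 1) U j b : 𝔸) - 1‖ ≤ εU j) →
      ∀ {α : ℝ}, 0 ≤ α → α ≤ α₀ →
        (∀ (b : Bond d (towerP L m (n + 1))) (v u : W), ⟪adTransportW φ U b v, u⟫_ℂ = ⟪v, adTransportW φ (fun b => (U b)⁻¹) b u⟫_ℂ) →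
        (∀ b, U b ∈ U1 𝔸) → (∀ b, ‖(U b : 𝔸) - 1‖ ≤ α * η) →
        (∀ p : B9SectCLatticeCarrier.Plaq d (towerP L m (n + 1)), ‖(plaqHolU U p : 𝔸) - 1‖ ≤ α * η ^ 2) →
        (∀ j < n + 1, εU j ≤ α * r ^ j) →
        ∀ (Δ₁ : BondL2K ℂ d (towerP L m (n + 1)) c₀ W →ₗ[ℂ] BondL2K ℂ d (towerP L m (n + 1)) c₀ W) {θ : ℝ}, 0 ≤ θ → θ ≤ γ₁ / 2 →
        (∀ u v : BondL2K ℂ d (towerP L m (n + 1)) c₀ W, ‖⟪u, Δ₁ v⟫_ℂ - ⟪u, hessOp φ η U τ v⟫_ℂ‖ ≤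
            θ * Real.sqrt (‖covCurlL2K ℂ c₀ ((η : ℂ))⁻¹ (adTransportW φ (fun _ : Bond d (towerP L m (n + 1)) => (1 : 𝔸ˣ))) u‖ ^ 2 +
                  ‖covDivL2K ℂ c₀ ((η : ℂ))⁻¹ (adTransportW φ fun _ : Bond d (towerP L m (n + 1)) => (1 : 𝔸ˣ)⁻¹) u‖ ^ 2 + ‖u‖ ^ 2) *
                Real.sqrt (‖covCurlL2K ℂ c₀ ((η : ℂ))⁻¹ (adTransportW φ (fun _ : Bond d (towerP L m (n + 1)) => (1 : 𝔸ˣ))) v‖ ^ 2 +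
                  ‖covDivL2K ℂ c₀ ((η : ℂ))⁻¹ (adTransportW φ fun _ : Bond d (towerP L m (n + 1)) => (1 : 𝔸ˣ)⁻¹) v‖ ^ 2 + ‖v‖ ^ 2)) →
        ∀ x : BondL2K ℂ d (towerP L m (n + 1)) c₀ W,
          γ₁ / 2 * (‖covCurlL2K ℂ c₀ ((η : ℂ))⁻¹ (adTransportW φ (fun _ : Bond d (towerP L m (n + 1)) => (1 : 𝔸ˣ))) x‖ ^ 2 +
              ‖covDivL2K ℂ c₀ ((η : ℂ))⁻¹ (adTransportW φ fun _ : Bond d (towerP L m (n + 1)) => (1 : 𝔸ˣ)⁻¹) x‖ ^ 2 + ‖x‖ ^ 2) ≤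
            RCLike.re ⟪x, laplaceALatticeK ((η : ℂ))⁻¹ (adTransportW φ U) (adTransportW φ fun b => (U b)⁻¹) Δ₁ (RofUk L m n φ η U)
              (QkW L m n φ U hL αU hα1 hU1 hreg (c₁ := c₁)) a x⟫_ℂ ∧
          ‖RofUk L m n φ η U (covDivL2K ℂ c₀ ((η : ℂ))⁻¹ (adTransportW φ fun b => (U b)⁻¹) x)‖ ^ 2 ≤
            4 * RCLike.re ⟪x, laplaceALatticeK ((η : ℂ))⁻¹ (adTransportW φ U) (adTransportW φ fun b => (U b)⁻¹) Δ₁ (RofUk L m n φ η U)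
              (QkW L m n φ U hL αU hα1 hU1 hreg (c₁ := c₁)) a x⟫_ℂ ∧
          a * ‖QkW L m n φ U hL αU hα1 hU1 hreg (c₁ := c₁) x‖ ^ 2 ≤
            4 * RCLike.re ⟪x, laplaceALatticeK ((η : ℂ))⁻¹ (adTransportW φ U) (adTransportW φ fun b => (U b)⁻¹) Δ₁ (RofUk L m n φ η U)
              (QkW L m n φ U hL αU hα1 hU1 hreg (c₁ := c₁)) a x⟫_ℂ := by
  obtain ⟨α₀, γ₁, hα₀, hγ₁, H⟩ := exists_energy_letters_diagonal_closed (d := d) L hL φ hMφ hMφ' hφ hφ' ha hr0 hr1 τ hτ hCτ hρw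
  refine ⟨α₀, γ₁, hα₀, hγ₁, ?_⟩
  intro n η hηL c₀ c₁ _ _ hw hρ m _ U αU hα1 hU1 hreg εU hεU hUε α hα0 hαle hRS hUb hUη hpl hεg Δ₁ θ hθ0 hθle hθ x
  have HU := H n η hηL c₀ c₁ hw hρ m U αU hα1 hU1 hreg εU hεU hUε hα0 hαle hRS hUb hUη hpl hεg x
  -- the flat energy weight of `x`, squared (opaque)
  obtain ⟨S, hS⟩ : ∃ S : ℝ, S = ‖covCurlL2K ℂ c₀ ((η : ℂ))⁻¹ (adTransportW φ (fun _ : Bond d (towerP L m (n + 1)) => (1 : 𝔸ˣ))) x‖ ^ 2 +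
      ‖covDivL2K ℂ c₀ ((η : ℂ))⁻¹ (adTransportW φ fun _ : Bond d (towerP L m (n + 1)) => (1 : 𝔸ˣ)⁻¹) x‖ ^ 2 + ‖x‖ ^ 2 := ⟨_, rfl⟩
  have hS0 : 0 ≤ S := by rw [hS]; positivity
  have hE0 : γ₁ * S ≤ RCLike.re ⟪x, laplaceAk L m n φ η U hL αU hα1 hU1 hreg τ (c₀ := c₀) (c₁ := c₁) a x⟫_ℂ := by rw [hS]; exact HU.1
  have hR := HU.2.1
  have hQ := HU.2.2
  -- the two operators differ by the slot only
  have key : ⟪x, laplaceALatticeK ((η : ℂ))⁻¹ (adTransportW φ U) (adTransportW φ fun b => (U b)⁻¹) Δ₁ (RofUk L m n φ η U)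
          (QkW L m n φ U hL αU hα1 hU1 hreg (c₁ := c₁)) a x⟫_ℂ -
        ⟪x, laplaceAk L m n φ η U hL αU hα1 hU1 hreg τ (c₀ := c₀) (c₁ := c₁) a x⟫_ℂ = ⟪x, Δ₁ x⟫_ℂ - ⟪x, hessOp φ η U τ x⟫_ℂ := by
    simp only [laplaceAk, laplaceALatticeK, laplaceAK_apply, inner_add_right]
    ring
  have hdef : ‖⟪x, laplaceALatticeK ((η : ℂ))⁻¹ (adTransportW φ U) (adTransportW φ fun b => (U b)⁻¹) Δ₁ (RofUk L m n φ η U)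
          (QkW L m n φ U hL αU hα1 hU1 hreg (c₁ := c₁)) a x⟫_ℂ -
        ⟪x, laplaceAk L m n φ η U hL αU hα1 hU1 hreg τ (c₀ := c₀) (c₁ := c₁) a x⟫_ℂ‖ ≤ θ * S := by
    rw [key]
    refine (hθ x x).trans_eq ?_
    rw [mul_assoc, Real.mul_self_sqrt (by positivity), hS]
  have h1 := re_sub_ge hdef
  have hθS : θ * S ≤ γ₁ / 2 * S := mul_le_mul_of_nonneg_right hθle hS0
  have hi : γ₁ / 2 * S ≤ RCLike.re ⟪x, laplaceALatticeK ((η : ℂ))⁻¹ (adTransportW φ U) (adTransportW φ fun b => (U b)⁻¹) Δ₁ (RofUk L m n φ η U)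
      (QkW L m n φ U hL αU hα1 hU1 hreg (c₁ := c₁)) a x⟫_ℂ := by linarith
  refine ⟨by rw [hS] at hi; exact hi, by nlinarith, by nlinarith⟩

/-! ## §2 `G̃ = Δ̃⁻¹` and its flat `D`-rows -/

/-- **`‖G̃y‖, ‖curl₁(G̃y)‖, ‖div₁(G̃y)‖ ≤ 2γ₁⁻¹‖y‖` ON THE DIAGONAL FOR ANY SLOT WITH `θ ≤ γ₁∕2`** — the `k`-th-step Green's function of the perturbed operator at
ANY positivity witness, from §1 (i) by `B9Eq3153FrakGVariational.norm_G1K_le` ∕ `norm_apply_G1K_le`; [B9] Thm 3.4 ∕ 3.3's `L²`-Sobolev shadow for print's `G̃`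
((3.130)), no decay. [cite: Balaban1985BackgroundPropagators, (3.130) p.421, Thm 3.4 p.400, Thm 3.11 p.416] -/
theorem exists_norm_G1k_slot_le_diagonal_closed :
    ∃ α₀ γ₁ C : ℝ, 0 < α₀ ∧ 0 < γ₁ ∧ 0 < C ∧ ∀ (n : ℕ) (η : ℝ), η * (L : ℝ) ^ (n + 1) = 1 →
      ∀ (c₀ c₁ : ℝ) [Fact (0 < c₀)] [Fact (0 < c₁)], c₀ * ((L : ℝ) ^ (n + 1)) ^ d = c₁ → |η| ^ d / c₀ ≤ ρw →
      ∀ (m : Fin d → ℕ) [∀ i, NeZero (m i)] (U : Bond d (towerP L m (n + 1)) → 𝔸ˣ) (αU : ℕ → ℝ) (hα1 : ∀ j, αU j ≤ 1 / 64)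
        (hU1 : ∀ (j : ℕ) (x : B7Prop1Explicit.Site d) (κ : Fin d), perCfg (towerP L m (j + 1)) (UlevOf L m (n + 1) U j) x κ ∈ U1 𝔸)
        (hreg : ∀ (j : ℕ) (y : TSite d (towerP L m j)) (κ : Fin d) (r : Fin d → Fin L),
          ‖((Wcx L (perCfg (towerP L m (j + 1)) (UlevOf L m (n + 1) U j)) (cornerSite L y) κ (boxVec L r) : 𝔸ˣ) : 𝔸) - 1‖ ≤ αU j)
        (εU : ℕ → ℝ), (∀ j, 0 ≤ εU j) → (∀ (j : ℕ) (b : Bond d (towerP L m (j + 1))), ‖(UlevOf L m (n + 1) U j b : 𝔸) - 1‖ ≤ εU j) →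
      ∀ {α : ℝ}, 0 ≤ α → α ≤ α₀ →
        (∀ (b : Bond d (towerP L m (n + 1))) (v u : W), ⟪adTransportW φ U b v, u⟫_ℂ = ⟪v, adTransportW φ (fun b => (U b)⁻¹) b u⟫_ℂ) →
        (∀ b, U b ∈ U1 𝔸) → (∀ b, ‖(U b : 𝔸) - 1‖ ≤ α * η) →
        (∀ p : B9SectCLatticeCarrier.Plaq d (towerP L m (n + 1)), ‖(plaqHolU U p : 𝔸) - 1‖ ≤ α * η ^ 2) →
        (∀ j < n + 1, εU j ≤ α * r ^ j) →
        ∀ (Δ₁ : BondL2K ℂ d (towerP L m (n + 1)) c₀ W →ₗ[ℂ] BondL2K ℂ d (towerP L m (n + 1)) c₀ W) {θ : ℝ}, 0 ≤ θ → θ ≤ γ₁ / 2 →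
        (∀ u v : BondL2K ℂ d (towerP L m (n + 1)) c₀ W, ‖⟪u, Δ₁ v⟫_ℂ - ⟪u, hessOp φ η U τ v⟫_ℂ‖ ≤
            θ * Real.sqrt (‖covCurlL2K ℂ c₀ ((η : ℂ))⁻¹ (adTransportW φ (fun _ : Bond d (towerP L m (n + 1)) => (1 : 𝔸ˣ))) u‖ ^ 2 +
                  ‖covDivL2K ℂ c₀ ((η : ℂ))⁻¹ (adTransportW φ fun _ : Bond d (towerP L m (n + 1)) => (1 : 𝔸ˣ)⁻¹) u‖ ^ 2 + ‖u‖ ^ 2) *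
                Real.sqrt (‖covCurlL2K ℂ c₀ ((η : ℂ))⁻¹ (adTransportW φ (fun _ : Bond d (towerP L m (n + 1)) => (1 : 𝔸ˣ))) v‖ ^ 2 +
                  ‖covDivL2K ℂ c₀ ((η : ℂ))⁻¹ (adTransportW φ fun _ : Bond d (towerP L m (n + 1)) => (1 : 𝔸ˣ)⁻¹) v‖ ^ 2 + ‖v‖ ^ 2)) →
        ∀ (hpos₁ : ∀ x : BondL2K ℂ d (towerP L m (n + 1)) c₀ W, x ≠ 0 →
            0 < RCLike.re ⟪x, laplaceALatticeK ((η : ℂ))⁻¹ (adTransportW φ U) (adTransportW φ fun b => (U b)⁻¹) Δ₁ (RofUk L m n φ η U)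
              (QkW L m n φ U hL αU hα1 hU1 hreg (c₁ := c₁)) a x⟫_ℂ)
          (y : BondL2K ℂ d (towerP L m (n + 1)) c₀ W),
          ‖G1LatticeK hpos₁ y‖ ≤ C * ‖y‖ ∧
          ‖covCurlL2K ℂ c₀ ((η : ℂ))⁻¹ (adTransportW φ (fun _ : Bond d (towerP L m (n + 1)) => (1 : 𝔸ˣ))) (G1LatticeK hpos₁ y)‖ ≤ C * ‖y‖ ∧
          ‖covDivL2K ℂ c₀ ((η : ℂ))⁻¹ (adTransportW φ fun _ : Bond d (towerP L m (n + 1)) => (1 : 𝔸ˣ)⁻¹) (G1LatticeK hpos₁ y)‖ ≤ C * ‖y‖ := by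
  obtain ⟨α₀, γ₁, hα₀, hγ₁, H⟩ := exists_energy_letters_slot_diagonal_closed (d := d) L hL φ hMφ hMφ' hφ hφ' ha hr0 hr1 τ hτ hCτ hρw
  refine ⟨α₀, γ₁, (γ₁ / 2)⁻¹, hα₀, hγ₁, by positivity, ?_⟩
  intro n η hηL c₀ c₁ _ _ hw hρ m _ U αU hα1 hU1 hreg εU hεU hUε α hα0 hαle hRS hUb hUη hpl hεg Δ₁ θ hθ0 hθle hθ hpos₁ y
  have hγ2 : 0 < γ₁ / 2 := by positivity
  have Hx := H n η hηL c₀ c₁ hw hρ m U αU hα1 hU1 hreg εU hεU hUε hα0 hαle hRS hUb hUη hpl hεg Δ₁ hθ0 hθle hθ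
  have hcoer : ∀ x : BondL2K ℂ d (towerP L m (n + 1)) c₀ W,
      γ₁ / 2 * ‖x‖ ^ 2 ≤ RCLike.re ⟪x, laplaceALatticeK ((η : ℂ))⁻¹ (adTransportW φ U) (adTransportW φ fun b => (U b)⁻¹) Δ₁ (RofUk L m n φ η U)
        (QkW L m n φ U hL αU hα1 hU1 hreg (c₁ := c₁)) a x⟫_ℂ := fun x => (rows_of_strong hγ2 (Hx x).1).1
  have hPc : ∀ x : BondL2K ℂ d (towerP L m (n + 1)) c₀ W,
      ‖covCurlL2K ℂ c₀ ((η : ℂ))⁻¹ (adTransportW φ (fun _ : Bond d (towerP L m (n + 1)) => (1 : 𝔸ˣ))) x‖ ^ 2 ≤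
        (γ₁ / 2)⁻¹ * RCLike.re ⟪x, laplaceALatticeK ((η : ℂ))⁻¹ (adTransportW φ U) (adTransportW φ fun b => (U b)⁻¹) Δ₁ (RofUk L m n φ η U)
          (QkW L m n φ U hL αU hα1 hU1 hreg (c₁ := c₁)) a x⟫_ℂ := fun x => (rows_of_strong hγ2 (Hx x).1).2.1
  have hPd : ∀ x : BondL2K ℂ d (towerP L m (n + 1)) c₀ W,
      ‖covDivL2K ℂ c₀ ((η : ℂ))⁻¹ (adTransportW φ fun _ : Bond d (towerP L m (n + 1)) => (1 : 𝔸ˣ)⁻¹) x‖ ^ 2 ≤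
        (γ₁ / 2)⁻¹ * RCLike.re ⟪x, laplaceALatticeK ((η : ℂ))⁻¹ (adTransportW φ U) (adTransportW φ fun b => (U b)⁻¹) Δ₁ (RofUk L m n φ η U)
          (QkW L m n φ U hL αU hα1 hU1 hreg (c₁ := c₁)) a x⟫_ℂ := fun x => (rows_of_strong hγ2 (Hx x).1).2.2
  have hsq : Real.sqrt ((γ₁ / 2)⁻¹ / (γ₁ / 2)) = (γ₁ / 2)⁻¹ := by
    rw [div_eq_mul_inv, Real.sqrt_mul_self (inv_nonneg.2 hγ2.le)]
  refine ⟨norm_G1K_le (𝕜 := ℂ) hpos₁ hγ2 hcoer y, ?_, ?_⟩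
  · calc _ ≤ Real.sqrt ((γ₁ / 2)⁻¹ / (γ₁ / 2)) * ‖y‖ := norm_apply_G1K_le (𝕜 := ℂ) hpos₁ hγ2 hcoer
          (covCurlL2K ℂ c₀ ((η : ℂ))⁻¹ (adTransportW φ (fun _ : Bond d (towerP L m (n + 1)) => (1 : 𝔸ˣ)))) (inv_nonneg.2 hγ2.le) hPc y
      _ = (γ₁ / 2)⁻¹ * ‖y‖ := by rw [hsq]
  · calc _ ≤ Real.sqrt ((γ₁ / 2)⁻¹ / (γ₁ / 2)) * ‖y‖ := norm_apply_G1K_le (𝕜 := ℂ) hpos₁ hγ2 hcoer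
          (covDivL2K ℂ c₀ ((η : ℂ))⁻¹ (adTransportW φ fun _ : Bond d (towerP L m (n + 1)) => (1 : 𝔸ˣ)⁻¹)) (inv_nonneg.2 hγ2.le) hPd y
      _ = (γ₁ / 2)⁻¹ * ‖y‖ := by rw [hsq]


/-! ## §3 `H̃_{1,k}(U)Q_k(U)G̃_k(U)` and its flat `D`-rows -/

-- deep definitional unfolding of the composite letters `H1LatticeK`∕`frakGLatticeK` ↦ `H1K`∕`frakGLin` (as in `B9Eq3153FrakGkBoundDiagonal`)
set_option maxRecDepth 8192 in
/-- **`‖H̃_{1,k}(Q_k(G̃y))‖, ‖curl₁(…)‖, ‖div₁(…)‖ ≤ 2γ₁⁻¹‖y‖` ON THE DIAGONAL FOR ANY SLOT WITH `θ ≤ γ₁∕2`, NO `H`-LETTER** — the second piece of (3.153) for the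
perturbed operator: `H̃_{1,k}b` minimises the `Δ̃`-energy on `{Q_kx = b}` ([B11] (45); print's (3.126) `HB = G̃Q*(QG̃Q*)⁻¹B`) and `G̃y` is admissible for
`b = Q_k(G̃y)`; for `Δ̃` symmetric (`hsymm`; `B9Eq3119DeltaPiTower.laplaceAkPi_isSymmetric` for the instance), ANY positivity witness and ANY onto-witness of
`Q_k(U)` (`B9Eq3153FrakGVariational` §3 at §1's letters). [folklore]
[cite: Balaban1985BackgroundPropagators, (3.126) p.420, (3.153) p.426, (3.130) p.421; Balaban1985Variational, (45) p.285] -/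
theorem exists_norm_H1k_Qk_G1k_slot_le_diagonal_closed :
    ∃ α₀ γ₁ C : ℝ, 0 < α₀ ∧ 0 < γ₁ ∧ 0 < C ∧ ∀ (n : ℕ) (η : ℝ), η * (L : ℝ) ^ (n + 1) = 1 →
      ∀ (c₀ c₁ : ℝ) [Fact (0 < c₀)] [Fact (0 < c₁)], c₀ * ((L : ℝ) ^ (n + 1)) ^ d = c₁ → |η| ^ d / c₀ ≤ ρw →
      ∀ (m : Fin d → ℕ) [∀ i, NeZero (m i)] (U : Bond d (towerP L m (n + 1)) → 𝔸ˣ) (αU : ℕ → ℝ) (hα1 : ∀ j, αU j ≤ 1 / 64)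
        (hU1 : ∀ (j : ℕ) (x : B7Prop1Explicit.Site d) (κ : Fin d), perCfg (towerP L m (j + 1)) (UlevOf L m (n + 1) U j) x κ ∈ U1 𝔸)
        (hreg : ∀ (j : ℕ) (y : TSite d (towerP L m j)) (κ : Fin d) (r : Fin d → Fin L),
          ‖((Wcx L (perCfg (towerP L m (j + 1)) (UlevOf L m (n + 1) U j)) (cornerSite L y) κ (boxVec L r) : 𝔸ˣ) : 𝔸) - 1‖ ≤ αU j)
        (εU : ℕ → ℝ), (∀ j, 0 ≤ εU j) → (∀ (j : ℕ) (b : Bond d (towerP L m (j + 1))), ‖(UlevOf L m (n + 1) U j b : 𝔸) - 1‖ ≤ εU j) →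
      ∀ {α : ℝ}, 0 ≤ α → α ≤ α₀ →
        (∀ (b : Bond d (towerP L m (n + 1))) (v u : W), ⟪adTransportW φ U b v, u⟫_ℂ = ⟪v, adTransportW φ (fun b => (U b)⁻¹) b u⟫_ℂ) →
        (∀ b, U b ∈ U1 𝔸) → (∀ b, ‖(U b : 𝔸) - 1‖ ≤ α * η) →
        (∀ p : B9SectCLatticeCarrier.Plaq d (towerP L m (n + 1)), ‖(plaqHolU U p : 𝔸) - 1‖ ≤ α * η ^ 2) →
        (∀ j < n + 1, εU j ≤ α * r ^ j) →
        ∀ (Δ₁ : BondL2K ℂ d (towerP L m (n + 1)) c₀ W →ₗ[ℂ] BondL2K ℂ d (towerP L m (n + 1)) c₀ W) {θ : ℝ}, 0 ≤ θ → θ ≤ γ₁ / 2 →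
        (∀ u v : BondL2K ℂ d (towerP L m (n + 1)) c₀ W, ‖⟪u, Δ₁ v⟫_ℂ - ⟪u, hessOp φ η U τ v⟫_ℂ‖ ≤
            θ * Real.sqrt (‖covCurlL2K ℂ c₀ ((η : ℂ))⁻¹ (adTransportW φ (fun _ : Bond d (towerP L m (n + 1)) => (1 : 𝔸ˣ))) u‖ ^ 2 +
                  ‖covDivL2K ℂ c₀ ((η : ℂ))⁻¹ (adTransportW φ fun _ : Bond d (towerP L m (n + 1)) => (1 : 𝔸ˣ)⁻¹) u‖ ^ 2 + ‖u‖ ^ 2) *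
                Real.sqrt (‖covCurlL2K ℂ c₀ ((η : ℂ))⁻¹ (adTransportW φ (fun _ : Bond d (towerP L m (n + 1)) => (1 : 𝔸ˣ))) v‖ ^ 2 +
                  ‖covDivL2K ℂ c₀ ((η : ℂ))⁻¹ (adTransportW φ fun _ : Bond d (towerP L m (n + 1)) => (1 : 𝔸ˣ)⁻¹) v‖ ^ 2 + ‖v‖ ^ 2)) →
        (laplaceALatticeK ((η : ℂ))⁻¹ (adTransportW φ U) (adTransportW φ fun b => (U b)⁻¹) Δ₁ (RofUk L m n φ η U)
          (QkW L m n φ U hL αU hα1 hU1 hreg (c₁ := c₁)) a).IsSymmetric →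
        ∀ (hpos₁ : ∀ x : BondL2K ℂ d (towerP L m (n + 1)) c₀ W, x ≠ 0 →
            0 < RCLike.re ⟪x, laplaceALatticeK ((η : ℂ))⁻¹ (adTransportW φ U) (adTransportW φ fun b => (U b)⁻¹) Δ₁ (RofUk L m n φ η U)
              (QkW L m n φ U hL αU hα1 hU1 hreg (c₁ := c₁)) a x⟫_ℂ)
          (hQ : Function.Surjective (QkW L m n φ U hL αU hα1 hU1 hreg (c₁ := c₁)))
          (y : BondL2K ℂ d (towerP L m (n + 1)) c₀ W),
          ‖H1LatticeK hpos₁ hQ (QkW L m n φ U hL αU hα1 hU1 hreg (c₁ := c₁) (G1LatticeK hpos₁ y))‖ ≤ C * ‖y‖ ∧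
          ‖covCurlL2K ℂ c₀ ((η : ℂ))⁻¹ (adTransportW φ (fun _ : Bond d (towerP L m (n + 1)) => (1 : 𝔸ˣ)))
              (H1LatticeK hpos₁ hQ (QkW L m n φ U hL αU hα1 hU1 hreg (c₁ := c₁) (G1LatticeK hpos₁ y)))‖ ≤ C * ‖y‖ ∧
          ‖covDivL2K ℂ c₀ ((η : ℂ))⁻¹ (adTransportW φ fun _ : Bond d (towerP L m (n + 1)) => (1 : 𝔸ˣ)⁻¹)
              (H1LatticeK hpos₁ hQ (QkW L m n φ U hL αU hα1 hU1 hreg (c₁ := c₁) (G1LatticeK hpos₁ y)))‖ ≤ C * ‖y‖ := by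
  obtain ⟨α₀, γ₁, hα₀, hγ₁, H⟩ := exists_energy_letters_slot_diagonal_closed (d := d) L hL φ hMφ hMφ' hφ hφ' ha hr0 hr1 τ hτ hCτ hρw
  refine ⟨α₀, γ₁, (γ₁ / 2)⁻¹, hα₀, hγ₁, by positivity, ?_⟩
  intro n η hηL c₀ c₁ _ _ hw hρ m _ U αU hα1 hU1 hreg εU hεU hUε α hα0 hαle hRS hUb hUη hpl hεg Δ₁ θ hθ0 hθle hθ hsymm hpos₁ hQ y
  have hγ2 : 0 < γ₁ / 2 := by positivity
  have hLr : (0 : ℝ) < (L : ℝ) ^ (n + 1) := pow_pos (by exact_mod_cast Nat.pos_of_ne_zero (NeZero.ne L)) _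
  have hηL0 : 0 < η * (L : ℝ) ^ (n + 1) := by rw [hηL]; exact one_pos
  have hη0 : 0 < η := pos_of_mul_pos_left hηL0 hLr.le
  have hc : conj ((η : ℂ))⁻¹ = ((η : ℂ))⁻¹ := by rw [map_inv₀, Complex.conj_ofReal]
  have Hx := H n η hηL c₀ c₁ hw hρ m U αU hα1 hU1 hreg εU hεU hUε hα0 hαle hRS hUb hUη hpl hεg Δ₁ hθ0 hθle hθ
  have hcoer : ∀ x : BondL2K ℂ d (towerP L m (n + 1)) c₀ W,
      γ₁ / 2 * ‖x‖ ^ 2 ≤ RCLike.re ⟪x, laplaceALatticeK ((η : ℂ))⁻¹ (adTransportW φ U) (adTransportW φ fun b => (U b)⁻¹) Δ₁ (RofUk L m n φ η U)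
        (QkW L m n φ U hL αU hα1 hU1 hreg (c₁ := c₁)) a x⟫_ℂ := fun x => (rows_of_strong hγ2 (Hx x).1).1
  have hPc : ∀ x : BondL2K ℂ d (towerP L m (n + 1)) c₀ W,
      ‖covCurlL2K ℂ c₀ ((η : ℂ))⁻¹ (adTransportW φ (fun _ : Bond d (towerP L m (n + 1)) => (1 : 𝔸ˣ))) x‖ ^ 2 ≤
        (γ₁ / 2)⁻¹ * RCLike.re ⟪x, laplaceALatticeK ((η : ℂ))⁻¹ (adTransportW φ U) (adTransportW φ fun b => (U b)⁻¹) Δ₁ (RofUk L m n φ η U)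
          (QkW L m n φ U hL αU hα1 hU1 hreg (c₁ := c₁)) a x⟫_ℂ := fun x => (rows_of_strong hγ2 (Hx x).1).2.1
  have hPd : ∀ x : BondL2K ℂ d (towerP L m (n + 1)) c₀ W,
      ‖covDivL2K ℂ c₀ ((η : ℂ))⁻¹ (adTransportW φ fun _ : Bond d (towerP L m (n + 1)) => (1 : 𝔸ˣ)⁻¹) x‖ ^ 2 ≤
        (γ₁ / 2)⁻¹ * RCLike.re ⟪x, laplaceALatticeK ((η : ℂ))⁻¹ (adTransportW φ U) (adTransportW φ fun b => (U b)⁻¹) Δ₁ (RofUk L m n φ η U)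
          (QkW L m n φ U hL αU hα1 hU1 hreg (c₁ := c₁)) a x⟫_ℂ := fun x => (rows_of_strong hγ2 (Hx x).1).2.2
  have hsq : Real.sqrt ((γ₁ / 2)⁻¹ / (γ₁ / 2)) = (γ₁ / 2)⁻¹ := by
    rw [div_eq_mul_inv, Real.sqrt_mul_self (inv_nonneg.2 hγ2.le)]
  have hadj : ∀ (x : BondL2K ℂ d (towerP L m (n + 1)) c₀ W) (z : BondL2K ℂ d m c₁ W),
      ⟪QkW L m n φ U hL αU hα1 hU1 hreg (c₁ := c₁) x, z⟫_ℂ = ⟪x, LinearMap.adjoint (QkW L m n φ U hL αU hα1 hU1 hreg (c₁ := c₁)) z⟫_ℂ :=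
    fun x z => (LinearMap.adjoint_inner_right _ x z).symm
  have hinj := adjoint_injective_of_surjective _ hQ
  refine ⟨?_, ?_, ?_⟩
  · exact norm_H1K_Q_G1K_le (𝕜 := ℂ) hpos₁ hadj hinj hγ2 hcoer hsymm y
  · exact le_of_le_of_eq (norm_apply_H1K_Q_G1K_le (𝕜 := ℂ) hpos₁ hadj hinj hγ2 hcoer
      (covCurlL2K ℂ c₀ ((η : ℂ))⁻¹ (adTransportW φ (fun _ : Bond d (towerP L m (n + 1)) => (1 : 𝔸ˣ)))) (inv_nonneg.2 hγ2.le) hPc hsymm y) (by rw [hsq])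
  · exact le_of_le_of_eq (norm_apply_H1K_Q_G1K_le (𝕜 := ℂ) hpos₁ hadj hinj hγ2 hcoer
      (covDivL2K ℂ c₀ ((η : ℂ))⁻¹ (adTransportW φ fun _ : Bond d (towerP L m (n + 1)) => (1 : 𝔸ˣ)⁻¹)) (inv_nonneg.2 hγ2.le) hPd hsymm y) (by rw [hsq])

/-! ## §4 The third Green's letter `𝔊̃_k(U)` of the perturbed operator and its flat `D`-rows -/

-- deep definitional unfolding of the composite letters `H1LatticeK`∕`frakGLatticeK` ↦ `H1K`∕`frakGLin` (as in `B9Eq3153FrakGkBoundDiagonal`)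
set_option maxRecDepth 8192 in
/-- **[B9] THM 3.13's `L²` CLAUSE FOR THE `k`-TH-STEP `𝔊̃_k(U)` OF THE PERTURBED OPERATOR ON THE DIAGONAL, ABSTRACT IN THE SLOT**: there are `α₀, γ₁, C > 0`
(`C = 12γ₁⁻¹`, `α₀, γ₁` those of `B9Eq3153FrakGkBoundDiagonal` §1, closed in `(d, a, L, M_φ, M_φ′, r, C_τ, ρ_w)`) such that for every `n`, `η` (`ηL^{n+1} = 1`),
`c₀, c₁` (`c₀(L^{n+1})^d = c₁`, `|η|^d∕c₀ ≤ ρ_w`), `m`, background `U` of E162's data with `hRS` and the windows, `0 ≤ α ≤ α₀`, every slot `Δ₁` with form defect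
`θ·N₁(u)N₁(v)` against `Δ^η(U)`, `0 ≤ θ ≤ γ₁∕2`, `Δ̃ = Δ₁ + D_UR_kD*_U + Q_k*aQ_k` symmetric, ANY positivity witness `hpos₁` and ANY onto-witness `hQ` of `Q_k(U)`:
`‖𝔊̃_k(U)x‖ ≤ C‖x‖`, `‖curl₁(𝔊̃_k(U)x)‖ ≤ C‖x‖`, `‖div₁(𝔊̃_k(U)x)‖ ≤ C‖x‖` — (3.153) in the energy currency (`B9Eq3153FrakGVariational.norm_frakGLin_le_of_energy` ∕
`norm_apply_frakGLin_le_of_energy` at §1's letters, `c_R = 4`, `c_P = (γ₁∕2)⁻¹`).  For `Δ₁ := π_k†Δ^η(U)π_k` this is print's `𝔊̃` of (3.126)∕(3.153) built on `G̃` of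
(3.130), modulo the θ-letter ((3.120) + (3.36)).  LEVEL- AND VOLUME-FREE; no decay, no kernel bound. [folklore]
[cite: Balaban1985BackgroundPropagators, Thm 3.13 p.426, (3.153) p.426, (3.130) p.421, (3.122) p.420, Thm 3.11 p.416] -/
theorem exists_norm_frakGk_slot_le_diagonal_closed :
    ∃ α₀ γ₁ C : ℝ, 0 < α₀ ∧ 0 < γ₁ ∧ 0 < C ∧ ∀ (n : ℕ) (η : ℝ), η * (L : ℝ) ^ (n + 1) = 1 →
      ∀ (c₀ c₁ : ℝ) [Fact (0 < c₀)] [Fact (0 < c₁)], c₀ * ((L : ℝ) ^ (n + 1)) ^ d = c₁ → |η| ^ d / c₀ ≤ ρw →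
      ∀ (m : Fin d → ℕ) [∀ i, NeZero (m i)] (U : Bond d (towerP L m (n + 1)) → 𝔸ˣ) (αU : ℕ → ℝ) (hα1 : ∀ j, αU j ≤ 1 / 64)
        (hU1 : ∀ (j : ℕ) (x : B7Prop1Explicit.Site d) (κ : Fin d), perCfg (towerP L m (j + 1)) (UlevOf L m (n + 1) U j) x κ ∈ U1 𝔸)
        (hreg : ∀ (j : ℕ) (y : TSite d (towerP L m j)) (κ : Fin d) (r : Fin d → Fin L),
          ‖((Wcx L (perCfg (towerP L m (j + 1)) (UlevOf L m (n + 1) U j)) (cornerSite L y) κ (boxVec L r) : 𝔸ˣ) : 𝔸) - 1‖ ≤ αU j)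
        (εU : ℕ → ℝ), (∀ j, 0 ≤ εU j) → (∀ (j : ℕ) (b : Bond d (towerP L m (j + 1))), ‖(UlevOf L m (n + 1) U j b : 𝔸) - 1‖ ≤ εU j) →
      ∀ {α : ℝ}, 0 ≤ α → α ≤ α₀ →
        (∀ (b : Bond d (towerP L m (n + 1))) (v u : W), ⟪adTransportW φ U b v, u⟫_ℂ = ⟪v, adTransportW φ (fun b => (U b)⁻¹) b u⟫_ℂ) →
        (∀ b, U b ∈ U1 𝔸) → (∀ b, ‖(U b : 𝔸) - 1‖ ≤ α * η) →
        (∀ p : B9SectCLatticeCarrier.Plaq d (towerP L m (n + 1)), ‖(plaqHolU U p : 𝔸) - 1‖ ≤ α * η ^ 2) →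
        (∀ j < n + 1, εU j ≤ α * r ^ j) →
        ∀ (Δ₁ : BondL2K ℂ d (towerP L m (n + 1)) c₀ W →ₗ[ℂ] BondL2K ℂ d (towerP L m (n + 1)) c₀ W) {θ : ℝ}, 0 ≤ θ → θ ≤ γ₁ / 2 →
        (∀ u v : BondL2K ℂ d (towerP L m (n + 1)) c₀ W, ‖⟪u, Δ₁ v⟫_ℂ - ⟪u, hessOp φ η U τ v⟫_ℂ‖ ≤
            θ * Real.sqrt (‖covCurlL2K ℂ c₀ ((η : ℂ))⁻¹ (adTransportW φ (fun _ : Bond d (towerP L m (n + 1)) => (1 : 𝔸ˣ))) u‖ ^ 2 +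
                  ‖covDivL2K ℂ c₀ ((η : ℂ))⁻¹ (adTransportW φ fun _ : Bond d (towerP L m (n + 1)) => (1 : 𝔸ˣ)⁻¹) u‖ ^ 2 + ‖u‖ ^ 2) *
                Real.sqrt (‖covCurlL2K ℂ c₀ ((η : ℂ))⁻¹ (adTransportW φ (fun _ : Bond d (towerP L m (n + 1)) => (1 : 𝔸ˣ))) v‖ ^ 2 +
                  ‖covDivL2K ℂ c₀ ((η : ℂ))⁻¹ (adTransportW φ fun _ : Bond d (towerP L m (n + 1)) => (1 : 𝔸ˣ)⁻¹) v‖ ^ 2 + ‖v‖ ^ 2)) →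
        (laplaceALatticeK ((η : ℂ))⁻¹ (adTransportW φ U) (adTransportW φ fun b => (U b)⁻¹) Δ₁ (RofUk L m n φ η U)
          (QkW L m n φ U hL αU hα1 hU1 hreg (c₁ := c₁)) a).IsSymmetric →
        ∀ (hpos₁ : ∀ x : BondL2K ℂ d (towerP L m (n + 1)) c₀ W, x ≠ 0 →
            0 < RCLike.re ⟪x, laplaceALatticeK ((η : ℂ))⁻¹ (adTransportW φ U) (adTransportW φ fun b => (U b)⁻¹) Δ₁ (RofUk L m n φ η U)
              (QkW L m n φ U hL αU hα1 hU1 hreg (c₁ := c₁)) a x⟫_ℂ)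
          (hQ : Function.Surjective (QkW L m n φ U hL αU hα1 hU1 hreg (c₁ := c₁)))
          (x : BondL2K ℂ d (towerP L m (n + 1)) c₀ W),
          ‖frakGLatticeK hpos₁ hQ x‖ ≤ C * ‖x‖ ∧
          ‖covCurlL2K ℂ c₀ ((η : ℂ))⁻¹ (adTransportW φ (fun _ : Bond d (towerP L m (n + 1)) => (1 : 𝔸ˣ))) (frakGLatticeK hpos₁ hQ x)‖ ≤ C * ‖x‖ ∧
          ‖covDivL2K ℂ c₀ ((η : ℂ))⁻¹ (adTransportW φ fun _ : Bond d (towerP L m (n + 1)) => (1 : 𝔸ˣ)⁻¹) (frakGLatticeK hpos₁ hQ x)‖ ≤ C * ‖x‖ := by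
  obtain ⟨α₀, γ₁, hα₀, hγ₁, H⟩ := exists_energy_letters_slot_diagonal_closed (d := d) L hL φ hMφ hMφ' hφ hφ' ha hr0 hr1 τ hτ hCτ hρw
  refine ⟨α₀, γ₁, 6 * (γ₁ / 2)⁻¹, hα₀, hγ₁, by positivity, ?_⟩
  intro n η hηL c₀ c₁ _ _ hw hρ m _ U αU hα1 hU1 hreg εU hεU hUε α hα0 hαle hRS hUb hUη hpl hεg Δ₁ θ hθ0 hθle hθ hsymm hpos₁ hQ x
  have hγ2 : 0 < γ₁ / 2 := by positivity
  have hLr : (0 : ℝ) < (L : ℝ) ^ (n + 1) := pow_pos (by exact_mod_cast Nat.pos_of_ne_zero (NeZero.ne L)) _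
  have hηL0 : 0 < η * (L : ℝ) ^ (n + 1) := by rw [hηL]; exact one_pos
  have hη0 : 0 < η := pos_of_mul_pos_left hηL0 hLr.le
  have hc : conj ((η : ℂ))⁻¹ = ((η : ℂ))⁻¹ := by rw [map_inv₀, Complex.conj_ofReal]
  have Hx := H n η hηL c₀ c₁ hw hρ m U αU hα1 hU1 hreg εU hεU hUε hα0 hαle hRS hUb hUη hpl hεg Δ₁ hθ0 hθle hθ
  have hcoer : ∀ x : BondL2K ℂ d (towerP L m (n + 1)) c₀ W,
      γ₁ / 2 * ‖x‖ ^ 2 ≤ RCLike.re ⟪x, laplaceALatticeK ((η : ℂ))⁻¹ (adTransportW φ U) (adTransportW φ fun b => (U b)⁻¹) Δ₁ (RofUk L m n φ η U)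
        (QkW L m n φ U hL αU hα1 hU1 hreg (c₁ := c₁)) a x⟫_ℂ := fun x => (rows_of_strong hγ2 (Hx x).1).1
  have hPc : ∀ x : BondL2K ℂ d (towerP L m (n + 1)) c₀ W,
      ‖covCurlL2K ℂ c₀ ((η : ℂ))⁻¹ (adTransportW φ (fun _ : Bond d (towerP L m (n + 1)) => (1 : 𝔸ˣ))) x‖ ^ 2 ≤
        (γ₁ / 2)⁻¹ * RCLike.re ⟪x, laplaceALatticeK ((η : ℂ))⁻¹ (adTransportW φ U) (adTransportW φ fun b => (U b)⁻¹) Δ₁ (RofUk L m n φ η U)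
          (QkW L m n φ U hL αU hα1 hU1 hreg (c₁ := c₁)) a x⟫_ℂ := fun x => (rows_of_strong hγ2 (Hx x).1).2.1
  have hPd : ∀ x : BondL2K ℂ d (towerP L m (n + 1)) c₀ W,
      ‖covDivL2K ℂ c₀ ((η : ℂ))⁻¹ (adTransportW φ fun _ : Bond d (towerP L m (n + 1)) => (1 : 𝔸ˣ)⁻¹) x‖ ^ 2 ≤
        (γ₁ / 2)⁻¹ * RCLike.re ⟪x, laplaceALatticeK ((η : ℂ))⁻¹ (adTransportW φ U) (adTransportW φ fun b => (U b)⁻¹) Δ₁ (RofUk L m n φ η U)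
          (QkW L m n φ U hL αU hα1 hU1 hreg (c₁ := c₁)) a x⟫_ℂ := fun x => (rows_of_strong hγ2 (Hx x).1).2.2
  have hsq : Real.sqrt ((γ₁ / 2)⁻¹ / (γ₁ / 2)) = (γ₁ / 2)⁻¹ := by
    rw [div_eq_mul_inv, Real.sqrt_mul_self (inv_nonneg.2 hγ2.le)]
  have hadj : ∀ (x : BondL2K ℂ d (towerP L m (n + 1)) c₀ W) (z : BondL2K ℂ d m c₁ W),
      ⟪QkW L m n φ U hL αU hα1 hU1 hreg (c₁ := c₁) x, z⟫_ℂ = ⟪x, LinearMap.adjoint (QkW L m n φ U hL αU hα1 hU1 hreg (c₁ := c₁)) z⟫_ℂ :=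
    fun x z => (LinearMap.adjoint_inner_right _ x z).symm
  have hinj := adjoint_injective_of_surjective _ hQ
  have hRD : ∀ x : BondL2K ℂ d (towerP L m (n + 1)) c₀ W,
      ‖RofUk L m n φ η U (covDivL2K ℂ c₀ ((η : ℂ))⁻¹ (adTransportW φ fun b => (U b)⁻¹) x)‖ ^ 2 ≤
        4 * RCLike.re ⟪x, laplaceALatticeK ((η : ℂ))⁻¹ (adTransportW φ U) (adTransportW φ fun b => (U b)⁻¹) Δ₁ (RofUk L m n φ η U)
          (QkW L m n φ U hL αU hα1 hU1 hreg (c₁ := c₁)) a x⟫_ℂ := fun x => (Hx x).2.1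
  have hDD : ∀ (s : SiteL2K ℂ d (towerP L m (n + 1)) c₀ W) (y : BondL2K ℂ d (towerP L m (n + 1)) c₀ W),
      ⟪covDerivL2K ℂ c₀ ((η : ℂ))⁻¹ (adTransportW φ U) s, y⟫_ℂ = ⟪s, covDivL2K ℂ c₀ ((η : ℂ))⁻¹ (adTransportW φ fun b => (U b)⁻¹) y⟫_ℂ := by
    intro s y
    rw [← adjoint_covDerivL2K ((η : ℂ))⁻¹ hc _ _ hRS, LinearMap.adjoint_inner_right]
  have hRsym : ∀ s t : SiteL2K ℂ d (towerP L m (n + 1)) c₀ W, ⟪RofUk L m n φ η U s, t⟫_ℂ = ⟪s, RofUk L m n φ η U t⟫_ℂ :=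
    fun s t => RofUk_isSymmetric L m n φ η U s t
  have hRR : ∀ s : SiteL2K ℂ d (towerP L m (n + 1)) c₀ W, RofUk L m n φ η U (RofUk L m n φ η U s) = RofUk L m n φ η U s :=
    fun s => projR_projR _ _ s
  refine ⟨?_, ?_, ?_⟩
  · calc _ ≤ (2 + 4) * (γ₁ / 2)⁻¹ * ‖x‖ :=
          norm_frakGLin_le_of_energy (𝕜 := ℂ) hpos₁ hadj hinj hγ2 hcoer hsymm hDD hRsym hRR (by norm_num : (0 : ℝ) ≤ 4) hRD x
      _ = 6 * (γ₁ / 2)⁻¹ * ‖x‖ := by norm_num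
  · exact le_of_le_of_eq (norm_apply_frakGLin_le_of_energy (𝕜 := ℂ) hpos₁ hadj hinj hγ2 hcoer
      (covCurlL2K ℂ c₀ ((η : ℂ))⁻¹ (adTransportW φ (fun _ : Bond d (towerP L m (n + 1)) => (1 : 𝔸ˣ)))) (inv_nonneg.2 hγ2.le) hPc hsymm hDD hRsym hRR
      (by norm_num : (0 : ℝ) ≤ 4) hRD x) (by rw [hsq]; norm_num)
  · exact le_of_le_of_eq (norm_apply_frakGLin_le_of_energy (𝕜 := ℂ) hpos₁ hadj hinj hγ2 hcoer
      (covDivL2K ℂ c₀ ((η : ℂ))⁻¹ (adTransportW φ fun _ : Bond d (towerP L m (n + 1)) => (1 : 𝔸ˣ)⁻¹)) (inv_nonneg.2 hγ2.le) hPd hsymm hDD hRsym hRR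
      (by norm_num : (0 : ℝ) ≤ 4) hRD x) (by rw [hsq]; norm_num)

end Literature.MathematicalPhysics.QuantumFieldTheory.Balaban1983to89.B9Eq3153FrakGkBoundSlotDiagonal

end
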